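import Summits.AnomalousDissipation.AnomalousDissipation.Theorems.MomentParityPathExt
import Summits.AnomalousDissipation.AnomalousDissipation.Theorems.MomentParityPathSpace

/-! # Route MomentParity · crux `GalerkinEnsembleRealization` — line `Sketch`, stub `stub_supportApprox`

Support points of the limit law are pointwise limits of orbit paths of confined Galerkin orbits
along a subsequence of levels (stmt-AnomalousDissipation-11466; Foias–Rosa–Temam 2013,
arXiv:1111.6257, proof of Thm. 3.1).

The trajectory space `𝒦 = pathSpace R L` is a subspace of the countable product
`ℚ × (Fin 3 → ℤ) → EuclideanSpace ℂ (Fin 3)`, hence first countable: a point `ω` has a decreasing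
countable neighbourhood basis `U i`. If every neighbourhood of `ω` is charged by the level laws
`P j` for arbitrarily large `j` ("support charging"), a diagonal extraction
(`Filter.extraction_forall_of_frequently`) gives levels `φ 0 < φ 1 < ⋯` with
`0 < P (φ i) (interior (U i))`; each such open set contains the orbit path of a confined Galerkin
datum `c i` (hypothesis `hP`), these orbit paths converge to `ω` in `𝒦`, and the continuity of the
continuous-time extension `ω ↦ ω̄(t, k)` on `𝒦` (`continuous_pathExt_subtype`) turns this into
pointwise convergence of the extensions at every real time and frequency.
-/

noncomputable section

-- every `Summit.AnomalousDissipation.AnomalousDissipation.…` name repeats the summit = sub-problem segment (D-0017 layout)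
set_option linter.dupNamespace false

open MeasureTheory Set Filter Topology Function Metric
open scoped BigOperators

namespace Summit.AnomalousDissipation.AnomalousDissipation.Theorems.MomentParity

open Literature.Analysis.FunctionSpaces Literature.Analysis.FunctionSpaces.Torus
open Literature.Analysis.FluidPDE Literature.Analysis.FluidPDE.Torus

/-- **Support approximation.** Let `P j` be measures on the trajectory space `𝒦 = pathSpace R L`
charging open sets only through orbit paths of confined level-`N j` Galerkin data (`hP`), and let
`ω ∈ 𝒦` be a point every neighbourhood of which has positive `P j`-mass for arbitrarily large `j`
(`hω`). Then along a strictly increasing sequence of indices `φ` there are confined Galerkin data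
`c i` of level `N (φ i)` whose orbit paths lie in `𝒦` and whose continuous-time extensions converge
to the extension of `ω` at every time `t ≥ 0` and every frequency `k`. -/
theorem stub_supportApprox {ν R : ℝ} {L : (Fin 3 → ℤ) → ℝ} {N : ℕ → ℕ}
    {g : (j : ℕ) → ↥(freqBall (N j) : Finset (Fin 3 → ℤ)) → EuclideanSpace ℂ (Fin 3)}
    (P : ℕ → Measure ↥(pathSpace R L : Set (Path (Fin 3))))
    (hP : ∀ j (U : Set ↥(pathSpace R L : Set (Path (Fin 3)))), IsOpen U → 0 < P j U →
      ∃ c : ↥(freqBall (N j) : Finset (Fin 3 → ℤ)) → EuclideanSpace ℂ (Fin 3),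
        c ∈ galerkinSubspace (freqBall (N j)) ∧
        (∀ t, 0 ≤ t → ∑ k ∈ freqBall (N j), ‖coeffExt (freqBall (N j))
          (galerkinCoeffFlow ν (g j) t c) k‖ ^ 2 ≤ R ^ 2) ∧
        ∃ h : orbitPath ν (g j) c ∈ pathSpace R L,
          (⟨orbitPath ν (g j) c, h⟩ : ↥(pathSpace R L : Set (Path (Fin 3)))) ∈ U)
    {ω : ↥(pathSpace R L : Set (Path (Fin 3)))}
    (hω : ∀ U ∈ 𝓝 ω, ∀ i : ℕ, ∃ j, i ≤ j ∧ 0 < P j U) :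
    ∃ φ : ℕ → ℕ, StrictMono φ ∧
      ∃ c : (i : ℕ) → ↥(freqBall (N (φ i)) : Finset (Fin 3 → ℤ)) → EuclideanSpace ℂ (Fin 3),
        (∀ i, c i ∈ galerkinSubspace (freqBall (N (φ i)))) ∧
        (∀ i t, 0 ≤ t → ∑ k ∈ freqBall (N (φ i)), ‖coeffExt (freqBall (N (φ i)))
          (galerkinCoeffFlow ν (g (φ i)) t (c i)) k‖ ^ 2 ≤ R ^ 2) ∧
        (∀ i, orbitPath ν (g (φ i)) (c i) ∈ pathSpace R L) ∧
        ∀ t, 0 ≤ t → ∀ k, Tendsto (fun i => pathExt (orbitPath ν (g (φ i)) (c i)) t k) atTop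
          (𝓝 (pathExt ω.1 t k)) := by
  -- a decreasing countable neighbourhood basis of `ω` (the trajectory space is first countable)
  obtain ⟨U, hU⟩ := (𝓝 ω).exists_antitone_basis
  -- diagonal extraction of levels charging the open neighbourhoods `interior (U i)`
  have hfreq : ∀ i, ∃ᶠ j in atTop, 0 < P j (interior (U i)) := fun i =>
    frequently_atTop.2 fun n => hω _ (interior_mem_nhds.2 (hU.mem i)) n
  obtain ⟨φ, hφ, hφP⟩ := extraction_forall_of_frequently hfreq
  -- confined Galerkin data whose orbit paths lie in these neighbourhoods
  have hc : ∀ i, ∃ c : ↥(freqBall (N (φ i)) : Finset (Fin 3 → ℤ)) → EuclideanSpace ℂ (Fin 3),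
      c ∈ galerkinSubspace (freqBall (N (φ i))) ∧
      (∀ t, 0 ≤ t → ∑ k ∈ freqBall (N (φ i)), ‖coeffExt (freqBall (N (φ i)))
        (galerkinCoeffFlow ν (g (φ i)) t c) k‖ ^ 2 ≤ R ^ 2) ∧
      ∃ h : orbitPath ν (g (φ i)) c ∈ pathSpace R L,
        (⟨orbitPath ν (g (φ i)) c, h⟩ : ↥(pathSpace R L : Set (Path (Fin 3)))) ∈ interior (U i) :=
    fun i => hP (φ i) (interior (U i)) isOpen_interior (hφP i)
  choose c hcV hconf hmem hcU using hc
  refine ⟨φ, hφ, c, hcV, hconf, hmem, fun t _ k => ?_⟩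
  -- the orbit paths converge to `ω` in the trajectory space, and `ω ↦ ω̄(t, k)` is continuous
  have hx : Tendsto
      (fun i => (⟨orbitPath ν (g (φ i)) (c i), hmem i⟩ : ↥(pathSpace R L : Set (Path (Fin 3)))))
      atTop (𝓝 ω) :=
    hU.tendsto fun i => interior_subset (hcU i)
  -- (elaborate the composition before matching it against the goal: a direct `exact` times out)
  have h := ((continuous_pathExt_subtype R L t k).tendsto ω).comp hx
  exact h

end Summit.AnomalousDissipation.AnomalousDissipation.Theorems.MomentParity
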